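import Summits.QuantumFields.BalabanUV.T4Continuum.Spine.NE1p.DressedSmallFieldCoresComplexSource

/-!
# T⁴ programme, spine estimate NE1′ (node O3b/H2) — WITNESS TAIL «THE END's BOUND HAS A LOCATED FLOOR ON THE DATUM»: a TWO-SIDED sandwich
# for the cores ENDs' bounded quantities on W33's and W35's decided data — `c_floor·‖s − s′‖ ≤ ‖E_s(X₀) − E_{s′}(X₀)‖ ≤ C_END` — and the
# slack between OUR floor and the located END constant, in closed form

Cell `pub-balaban`, sub-cell `t4`, row NE1′ formalisation crew (`t4/formal/NE1p/LEAVES.md` row **W113 ∕ DAG N29zzzzzze**; INTENT `HOME/CLAIMS.log`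
l.25732, STAGED l.25787, BOOKED typer RULING R-T157 l.25813; read X262), unit `b2b-balaban-t4-ne1p-formalise-leaf-09` (gen 15).  ADDITIVE — imports W105
`Spine/NE1p/DressedSmallFieldCoresComplexSource` (p245344; → W100 P1 `DressedSmallFieldPencilInjective` p244860, W47 → W41 → W35 → W33 → W24) ONLY;
own namespace; THEOREMS ONLY (0 def, 0 `def … : Prop`, 0 cite, 0 sorry, 0 `attribute`); W24's `exp_locE_cube`, W33's `norm_actW_X₀_lt_one` ∕
`coresEnd_fires_closed` ∕ `cW` ∕ `crd` ∕ `gaussian_E1`-style transfer, W35's `norm_actM_X₀_lt_one` ∕ `coresMuEnd_fires_closed` ∕ `cM`, W100's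
`pencil` ∕ `pencilM` ∕ `pencil_coLipschitz` ∕ `actW_X₀_eq_pencil`, W105's `actM_X₀_eq_pencil` are used BY NAME — nothing restated.

WHY.  Every witness of the crew states that an END's bounded quantity is NOT ZERO (liveness); none says HOW LARGE it is.  W100 made the
one-cube pencil term CO-LIPSCHITZ in the complex source; two more [folklore] steps turn that into a FLOOR under the END's quantity itself:
* §1 **`norm_cexp_sub_cexp_le : ‖e^a − e^b‖ ≤ max ‖e^a‖ ‖e^b‖ · ‖a − b‖`** (Mathlib's convex-set mean value inequality on `segment ℝ a b`;
  `‖e^z‖ = e^{Re z}` is monotone along the segment) — so, W24's `exp_locE_cube` giving `e^{E_s} = 1 + w_s` with `‖w_s‖ < 1`,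
  **`‖w_s − w_{s′}‖ ≤ 2·‖E_s − E_{s′}‖`**: the activity increment is paid TWICE OVER by the output increment;
* §2 **`pencilM_eq : pencilM r = r·√(π∕2)`** — W100's first moment in CLOSED FORM (`(crd v)² = ‖v‖²` on `E1`, Mathlib
  `GaussianFourier.integral_rexp_neg_mul_sq_norm` at `b = 2`);
* §3 on W33's datum (N0p's cores END, table-strength pencil): **`coresEnd_floor`** — for `0 < r`, `‖s‖, ‖s′‖ ≤ ρ ≤ 1`, `ρr ≤ 1`:
  `(1 − 2ρr)·cW r·(r·√(π∕2))·‖s − s′‖ ∕ 2 ≤ ‖E_s(X₀) − E_{s′}(X₀)‖`; `coresEnd_sandwich` against W33's located `2·K₀(64,8)` at `(s, s′) = (1, 0)`;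
* §4 on W35's datum (N0q's μ-END, source pencil): **`coresMuEnd_floor`** (`ρ ≤ 2`) and **`coresMuEnd_sandwich`**: for `‖μ‖ ≤ μ₀ < μ₁ ≤ 2`,
  `μ₀r ≤ 1`: `(1 − 2μ₀r)·cM r·(r·√(π∕2))·‖μ‖ ∕ 2 ≤ ‖E_μ(X₀) − E_0(X₀)‖ ≤ K₀(64,8)·μ₀∕(μ₁ − μ₀)` (W35's `coresMuEnd_fires_closed` BY NAME);
* §5 THE SLACK, LOCATED [arith]: `cM r·r·√(π∕2) = Acst·r·e^{−2r}∕2` (`cM_mul_moment`), so at `(r, μ₀, μ₁) = (¼, 1, 2)` the sandwich reads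
  `e^{−1∕2}·Acst·‖μ‖∕32 ≤ ‖Δ_μE‖ ≤ K₀(64,8)` with `Acst = (e·K₀(64,8)·9·64)⁻¹`: the END's constant exceeds OUR floor at `‖μ‖ = 1` by the factor
  `32·e^{1∕2}·e·9·64·K₀(64,8)² = 18432·e^{3∕2}·K₀(64,8)²` (`slack_located`) — the price of the END's generality on THIS decided toy.

HONEST FRAMING.  DECIDED TOYS ([folklore] + [arith]; 0 sorry; 0 citations; no `def`): the floor and the slack are statements about OUR Gaussian
cores on NE5's toy frame and OUR located END constants; they say NOTHING about Bałaban's (2.14) densities (which may sit anywhere in the ENDs'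
hypothesis class) and do NOT claim the ENDs are unsharp on that class (W102 ∕ leaf-03's sharpness rows address the abstract classes); the radius
conditions `ρr ≤ 1`, `2ρr < 1` are W100's METHOD's; no END newly fired — no binder of N0p ∕ N0q exercised beyond what W33 ∕ W35 fire; the
μ-extension READING stays the cell's, UNPRINTED (C-t4r2-340 (n1)); (B1b) NOT claimed; (B3) = W24's located constant BY CHOICE in W33 ∕ W35
(G-ne9p2-5 UNPRINTED) — which is exactly WHY the floor is `Acst`-scale while the END is `K₀`-scale; 0 binders instantiated on Bałaban's densities;
no wall item; wall v1.8 (T4-DAG v48; v49–v56 verbatim) — words, not kind — does NOT move; R-t4r2-Q2 NOT met; NE1′ ⇐ the named binders — NOT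
proved, NOT printed; spine PROVED 0∕9; count 9 unchanged.  Rung (B)+1 on ONE finite four-torus — NOT infinite volume, NOT a mass gap, NOT OS on
ℝ⁴, NOT Clay.
HONEST DEPENDENCY: continuum YM on T⁴ ⇐ BetaPertH ∧ nine spine estimates (0/9 proved); BetaPertH ⇐ (D1) ∧ (D4) ∧ CAP+tail; G-an2-4
gates asym, D1 and NE2/3/4.
-/

noncomputable section

namespace Summit.QuantumFields.BalabanUV.T4Continuum.NE1p.DressedSmallFieldPencilFloor

open Set Metric MeasureTheory Complex
open scoped BigOperators
open Literature.MathematicalPhysics.QuantumFieldTheory.Balaban1983to89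
open Literature.MathematicalPhysics.QuantumFieldTheory.Balaban1983to89.B12TreeDecay (K₀ K₀_pos)
open Literature.MathematicalPhysics.QuantumFieldTheory.Balaban1983to89.B13Resummation (locE)
open Literature.MathematicalPhysics.QuantumFieldTheory.Balaban1983to89.TreeLengthTorus (TDom tsys)
open Literature.MathematicalPhysics.QuantumFieldTheory.Balaban1983to89.TreeLengthTorusGeometry (tgeometry TTouch)
open Summit.QuantumFields.BalabanUV.T4Continuum.NE1p.DressedSmallFieldTorusWitness (X₀ exp_locE_cube)
open Summit.QuantumFields.BalabanUV.T4Continuum.NE1p.DressedSmallFieldCoresWitness (E1 crd Acst Acst_pos cW cW_pos actW norm_actW_X₀_lt_one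
  coresEnd_fires_closed)
open Summit.QuantumFields.BalabanUV.T4Continuum.NE1p.DressedSmallFieldCoresMassWitness (cM cM_pos actM norm_actM_X₀_lt_one coresMuEnd_fires_closed)
open Summit.QuantumFields.BalabanUV.T4Continuum.NE1p.DressedSmallFieldPencilInjective (pencil pencilM pencilM_pos pencilM_nonneg pencil_coLipschitz
  actW_X₀_eq_pencil)
open Summit.QuantumFields.BalabanUV.T4Continuum.NE1p.DressedSmallFieldCoresComplexSource (actM_X₀_eq_pencil)

/-! ## §1 THE EXPONENTIAL PAYS AT MOST `max ‖e^a‖ ‖e^b‖` PER UNIT: a lower bound on `‖a − b‖` from `‖e^a − e^b‖` -/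

/-- Along the segment `[a, b]` the modulus `‖e^z‖ = e^{Re z}` stays below `max ‖e^a‖ ‖e^b‖` (`Re` is affine, `exp` monotone). [folklore] -/
theorem norm_cexp_le_of_mem_segment {a b z : ℂ} (hz : z ∈ segment ℝ a b) : ‖cexp z‖ ≤ max ‖cexp a‖ ‖cexp b‖ := by
  obtain ⟨x, y, hx, hy, hxy, rfl⟩ := hz
  rw [Complex.norm_exp, Complex.norm_exp, Complex.norm_exp]
  have hre : (x • a + y • b).re = x * a.re + y * b.re := by simp
  rw [hre]
  rcases le_total a.re b.re with hab | hab
  · have h1 : x * a.re ≤ x * b.re := mul_le_mul_of_nonneg_left hab hx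
    have h2 : x * b.re + y * b.re = b.re := by rw [← add_mul, hxy, one_mul]
    exact (Real.exp_le_exp.2 (by linarith)).trans (le_max_right _ _)
  · have h1 : y * b.re ≤ y * a.re := mul_le_mul_of_nonneg_left hab hy
    have h2 : x * a.re + y * a.re = a.re := by rw [← add_mul, hxy, one_mul]
    exact (Real.exp_le_exp.2 (by linarith)).trans (le_max_left _ _)

/-- **`‖e^a − e^b‖ ≤ max ‖e^a‖ ‖e^b‖ · ‖a − b‖`** — the mean value inequality for `exp` on the segment `[b, a]`
(`Convex.norm_image_sub_le_of_norm_hasDerivWithin_le`). [folklore] -/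
theorem norm_cexp_sub_cexp_le (a b : ℂ) : ‖cexp a - cexp b‖ ≤ max ‖cexp a‖ ‖cexp b‖ * ‖a - b‖ := by
  have h := Convex.norm_image_sub_le_of_norm_hasDerivWithin_le (f := cexp) (f' := cexp) (s := segment ℝ b a) (x := b) (y := a)
    (C := max ‖cexp b‖ ‖cexp a‖) (fun z _ => (Complex.hasDerivAt_exp z).hasDerivWithinAt)
    (fun z hz => norm_cexp_le_of_mem_segment hz) (convex_segment b a) (left_mem_segment ℝ b a) (right_mem_segment ℝ b a)
  rwa [max_comm] at h

/-- **THE OUTPUT INCREMENT PAYS FOR THE ACTIVITY INCREMENT, TWICE OVER**: if `e^{E} = 1 + w` and `e^{E′} = 1 + w′` with `‖w‖, ‖w′‖ < 1`, then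
`‖w − w′‖ ≤ 2·‖E − E′‖`. [folklore] -/
theorem norm_sub_le_two_mul_norm_sub {E E' w w' : ℂ} (hE : cexp E = 1 + w) (hE' : cexp E' = 1 + w') (hw : ‖w‖ < 1) (hw' : ‖w'‖ < 1) :
    ‖w - w'‖ ≤ 2 * ‖E - E'‖ := by
  have h := norm_cexp_sub_cexp_le E E'
  rw [hE, hE', add_sub_add_left_eq_sub] at h
  have hm : max ‖1 + w‖ ‖1 + w'‖ ≤ 2 := by
    refine max_le ?_ ?_
    · calc ‖1 + w‖ ≤ ‖(1 : ℂ)‖ + ‖w‖ := norm_add_le _ _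
        _ ≤ 2 := by rw [norm_one]; linarith
    · calc ‖1 + w'‖ ≤ ‖(1 : ℂ)‖ + ‖w'‖ := norm_add_le _ _
        _ ≤ 2 := by rw [norm_one]; linarith
  exact h.trans (mul_le_mul_of_nonneg_right hm (norm_nonneg _))

/-! ## §2 W100's FIRST MOMENT IN CLOSED FORM: `pencilM r = r·√(π∕2)` -/

/-- On the one-variable Euclidean space the coordinate's square IS the norm's square: `(crd v)² = ‖v‖²`. [folklore] -/
theorem crd_sq_eq_norm_sq (v : E1) : crd v ^ 2 = ‖v‖ ^ 2 := by
  rw [EuclideanSpace.norm_sq_eq, Fin.sum_univ_one, Real.norm_eq_abs, sq_abs]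
  rfl

/-- The first-moment integrand is the Gaussian at `b = 2`: `r·e^{−(crd v)²}·e^{−‖v‖²} = r·e^{−2‖v‖²}`. [folklore] -/
theorem moment_integrand_eq (r : ℝ) (v : E1) :
    r * Real.exp (-(crd v ^ 2)) * Real.exp (-‖v‖ ^ 2) = r * Real.exp (-2 * ‖v‖ ^ 2) := by
  rw [crd_sq_eq_norm_sq, mul_assoc, ← Real.exp_add]
  congr 1; congr 1; ring

/-- **`pencilM r = r·√(π∕2)`** (Mathlib's Gaussian integral on an inner-product space, `finrank ℝ E1 = 1`). [folklore] -/
theorem pencilM_eq (r : ℝ) : pencilM r = r * Real.sqrt (Real.pi / 2) := by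
  unfold pencilM
  simp_rw [moment_integrand_eq]
  rw [integral_const_mul]
  congr 1
  have h := GaussianFourier.integral_rexp_neg_mul_sq_norm (V := E1) (b := 2) (by norm_num)
  simp only [finrank_euclideanSpace, Fintype.card_fin, Nat.cast_one] at h
  rw [h, Real.sqrt_eq_rpow]

/-! ## §3 THE FLOOR ON W33's DATUM (N0p's cores END; table-strength pencil `s • liveTable`) -/

section Torus
variable (N : ℕ) [NeZero N] (r : ℝ) (hr : 0 ≤ r)

open Classical in
/-- **THE FLOOR UNDER N0p's CORES END QUANTITY** [decided toy]: for `‖s‖, ‖s′‖ ≤ ρ ≤ 1` and `ρr ≤ 1`,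
`(1 − 2ρr)·cW r·(r·√(π∕2))·‖s − s′‖ ∕ 2 ≤ ‖E_s(X₀) − E_{s′}(X₀)‖` — §1 (`e^{E_s} = 1 + actW s X₀` by W24's `exp_locE_cube`, `‖actW s X₀‖ < 1`
by W33's `norm_actW_X₀_lt_one`), then `actW s X₀ = cW r·pencil r s` (W100) and W100's `pencil_coLipschitz`, `pencilM_eq`. [folklore] -/
theorem coresEnd_floor (hr0 : 0 < r) (k : ℕ) {ρ : ℝ} (hρ1 : ρ ≤ 1) (hρr : ρ * r ≤ 1) {s s' : ℂ} (hs : ‖s‖ ≤ ρ) (hs' : ‖s'‖ ≤ ρ) :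
    (1 - 2 * ρ * r) * cW r * (r * Real.sqrt (Real.pi / 2)) * ‖s - s'‖ / 2 ≤
      ‖locE (tgeometry 4 N).ι (tgeometry 4 N).cubes (actW r hr N k s) ((tgeometry 4 N).cubes (X₀ N)) -
        locE (tgeometry 4 N).ι (tgeometry 4 N).cubes (actW r hr N k s') ((tgeometry 4 N).cubes (X₀ N))‖ := by
  have h1 := exp_locE_cube N (w := actW r hr N k s) (norm_actW_X₀_lt_one r hr N hr0 k (hs.trans hρ1))
  have h0 := exp_locE_cube N (w := actW r hr N k s') (norm_actW_X₀_lt_one r hr N hr0 k (hs'.trans hρ1))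
  have hpay := norm_sub_le_two_mul_norm_sub h1 h0 (norm_actW_X₀_lt_one r hr N hr0 k (hs.trans hρ1))
    (norm_actW_X₀_lt_one r hr N hr0 k (hs'.trans hρ1))
  have hact : actW r hr N k s (X₀ N) - actW r hr N k s' (X₀ N) = (cW r : ℂ) * (pencil r s - pencil r s') := by
    rw [actW_X₀_eq_pencil, actW_X₀_eq_pencil]; ring
  rw [hact, norm_mul, Complex.norm_real, Real.norm_eq_abs, abs_of_pos (cW_pos r)] at hpay
  have hco := pencil_coLipschitz r hr ((norm_nonneg s).trans hs) hρr hs hs'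
  rw [pencilM_eq] at hco
  have hc : 0 ≤ cW r := (cW_pos r).le
  have hmul := mul_le_mul_of_nonneg_left hco hc
  -- `cW·floor ≤ cW·‖pencil s − pencil s′‖ ≤ 2·‖E_s − E_s′‖` (the `TTouch`-form of `hpay` is the `tgeometry`-form by `rfl`)
  have hpay' : cW r * ‖pencil r s - pencil r s'‖ ≤
      2 * ‖locE (tgeometry 4 N).ι (tgeometry 4 N).cubes (actW r hr N k s) ((tgeometry 4 N).cubes (X₀ N)) -
        locE (tgeometry 4 N).ι (tgeometry 4 N).cubes (actW r hr N k s') ((tgeometry 4 N).cubes (X₀ N))‖ := hpay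
  linarith

open Classical in
/-- **THE SANDWICH AT W33's REAL PAIR `(1, 0)`** [decided toy + located]: for `0 < r ≤ 1`,
`(1 − 2r)·cW r·(r·√(π∕2)) ∕ 2 ≤ ‖E_1(X₀) − E_0(X₀)‖ ≤ 2·K₀(64,8)` — the floor of §3 at `ρ = 1` under W33's located END constant
(`coresEnd_fires_closed` BY NAME).  For `r ≥ ½` the floor is `≤ 0` and says nothing (W100's radius). [folklore] -/
theorem coresEnd_sandwich (hr0 : 0 < r) (hr1 : r ≤ 1) (k : ℕ) :
    (1 - 2 * 1 * r) * cW r * (r * Real.sqrt (Real.pi / 2)) * ‖(1 : ℂ) - 0‖ / 2 ≤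
        ‖locE (tgeometry 4 N).ι (tgeometry 4 N).cubes (actW r hr N k 1) ((tgeometry 4 N).cubes (X₀ N)) -
          locE (tgeometry 4 N).ι (tgeometry 4 N).cubes (actW r hr N k 0) ((tgeometry 4 N).cubes (X₀ N))‖ ∧
      ‖locE (tgeometry 4 N).ι (tgeometry 4 N).cubes (actW r hr N k 1) ((tgeometry 4 N).cubes (X₀ N)) -
          locE (tgeometry 4 N).ι (tgeometry 4 N).cubes (actW r hr N k 0) ((tgeometry 4 N).cubes (X₀ N))‖ ≤ 2 * K₀ 64 8 :=
  ⟨coresEnd_floor N r hr hr0 k (ρ := 1) le_rfl (by linarith) (by rw [norm_one]) (by rw [norm_zero]; exact zero_le_one),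
    coresEnd_fires_closed r hr N k⟩

/-! ## §4 THE FLOOR ON W35's DATUM (N0q's μ-END; SOURCE pencil) and the two-sided sandwich against `K₀(64,8)·μ₀∕(μ₁ − μ₀)` -/

open Classical in
/-- **THE FLOOR UNDER N0q's μ-END QUANTITY** [decided toy]: for `‖μ‖, ‖μ′‖ ≤ ρ ≤ 2` and `ρr ≤ 1`,
`(1 − 2ρr)·cM r·(r·√(π∕2))·‖μ − μ′‖ ∕ 2 ≤ ‖E_μ(X₀) − E_{μ′}(X₀)‖` (§1 with W35's `norm_actM_X₀_lt_one`, W105's `actM_X₀_eq_pencil`, W100's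
`pencil_coLipschitz`, `pencilM_eq`). [folklore] -/
theorem coresMuEnd_floor (k : ℕ) {ρ : ℝ} (hρ2 : ρ ≤ 2) (hρr : ρ * r ≤ 1) {μ μ' : ℂ} (hμ : ‖μ‖ ≤ ρ) (hμ' : ‖μ'‖ ≤ ρ) :
    (1 - 2 * ρ * r) * cM r * (r * Real.sqrt (Real.pi / 2)) * ‖μ - μ'‖ / 2 ≤
      ‖locE (tgeometry 4 N).ι (tgeometry 4 N).cubes (actM N r hr k μ) ((tgeometry 4 N).cubes (X₀ N)) -
        locE (tgeometry 4 N).ι (tgeometry 4 N).cubes (actM N r hr k μ') ((tgeometry 4 N).cubes (X₀ N))‖ := by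
  have h1 := exp_locE_cube N (w := actM N r hr k μ) (norm_actM_X₀_lt_one N r hr k (hμ.trans hρ2))
  have h0 := exp_locE_cube N (w := actM N r hr k μ') (norm_actM_X₀_lt_one N r hr k (hμ'.trans hρ2))
  have hpay := norm_sub_le_two_mul_norm_sub h1 h0 (norm_actM_X₀_lt_one N r hr k (hμ.trans hρ2))
    (norm_actM_X₀_lt_one N r hr k (hμ'.trans hρ2))
  have hact : actM N r hr k μ (X₀ N) - actM N r hr k μ' (X₀ N) = (cM r : ℂ) * (pencil r μ - pencil r μ') := by
    rw [actM_X₀_eq_pencil, actM_X₀_eq_pencil]; ring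
  rw [hact, norm_mul, Complex.norm_real, Real.norm_eq_abs, abs_of_pos (cM_pos r)] at hpay
  have hco := pencil_coLipschitz r hr ((norm_nonneg μ).trans hμ) hρr hμ hμ'
  rw [pencilM_eq] at hco
  have hmul := mul_le_mul_of_nonneg_left hco (cM_pos r).le
  have hpay' : cM r * ‖pencil r μ - pencil r μ'‖ ≤
      2 * ‖locE (tgeometry 4 N).ι (tgeometry 4 N).cubes (actM N r hr k μ) ((tgeometry 4 N).cubes (X₀ N)) -
        locE (tgeometry 4 N).ι (tgeometry 4 N).cubes (actM N r hr k μ') ((tgeometry 4 N).cubes (X₀ N))‖ := hpay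
  linarith

open Classical in
/-- **THE TWO-SIDED SANDWICH FOR N0q's μ-END ON W35's DATUM** [decided toy + located]: for `0 ≤ r`, `‖μ‖ ≤ μ₀ < μ₁ ≤ 2`, `0 < μ₀`, `μ₀r ≤ 1`:
`(1 − 2μ₀r)·cM r·(r·√(π∕2))·‖μ‖ ∕ 2 ≤ ‖E_μ(X₀) − E_0(X₀)‖ ≤ K₀(64,8)·μ₀∕(μ₁ − μ₀)` — OUR floor under W35's located END bound
(`coresMuEnd_fires_closed` BY NAME). [folklore] -/
theorem coresMuEnd_sandwich (k : ℕ) {μ₁ μ₀ : ℝ} (hμ₁ : μ₁ ≤ 2) (h0 : 0 < μ₀) (h01 : μ₀ < μ₁) (hμ₀r : μ₀ * r ≤ 1)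
    {μ : ℂ} (hμ : ‖μ‖ ≤ μ₀) :
    (1 - 2 * μ₀ * r) * cM r * (r * Real.sqrt (Real.pi / 2)) * ‖μ - 0‖ / 2 ≤
        ‖locE (tgeometry 4 N).ι (tgeometry 4 N).cubes (actM N r hr k μ) ((tgeometry 4 N).cubes (X₀ N)) -
          locE (tgeometry 4 N).ι (tgeometry 4 N).cubes (actM N r hr k 0) ((tgeometry 4 N).cubes (X₀ N))‖ ∧
      ‖locE (tgeometry 4 N).ι (tgeometry 4 N).cubes (actM N r hr k μ) ((tgeometry 4 N).cubes (X₀ N)) -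
          locE (tgeometry 4 N).ι (tgeometry 4 N).cubes (actM N r hr k 0) ((tgeometry 4 N).cubes (X₀ N))‖ ≤
        K₀ 64 8 * (μ₀ / (μ₁ - μ₀)) :=
  ⟨coresMuEnd_floor N r hr k (ρ := μ₀) (by linarith) hμ₀r hμ (by rw [norm_zero]; exact h0.le),
    coresMuEnd_fires_closed N r hr hμ₁ h0 h01 hμ k⟩

end Torus

/-! ## §5 THE SLACK, LOCATED [arith]: OUR floor is `Acst`-scale, the END's constant is `K₀`-scale -/

/-- The floor's letter in closed form: `cM r·(r·√(π∕2)) = Acst·r·e^{−2r} ∕ 2` (`cM r = Acst·e^{−2r}∕√(2π)`, `√(π∕2)∕√(2π) = ½`). [folklore] -/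
theorem cM_mul_moment (r : ℝ) : cM r * (r * Real.sqrt (Real.pi / 2)) = Acst * r * Real.exp (-(2 * r)) / 2 := by
  unfold cM
  have hπ : 0 < Real.pi := Real.pi_pos
  have h4 : Real.sqrt 4 = 2 := by
    rw [show (4 : ℝ) = 2 ^ 2 by norm_num, Real.sqrt_sq (by norm_num : (0 : ℝ) ≤ 2)]
  have hhalf : Real.sqrt (Real.pi / 2) = Real.sqrt (2 * Real.pi) / 2 := by
    rw [show Real.pi / 2 = 2 * Real.pi / 4 by ring, Real.sqrt_div (by positivity) 4, h4]
  rw [hhalf]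
  have hs : Real.sqrt (2 * Real.pi) ≠ 0 := (Real.sqrt_pos.2 (by positivity)).ne'
  field_simp

/-- **THE SLACK AT `(r, μ₀, μ₁) = (¼, 1, 2)`** [located arith]: there the sandwich of §4 reads
`(Acst·e^{−1∕2}∕32)·‖μ‖ ≤ ‖Δ_μE‖ ≤ K₀(64,8)` (floor coefficient `(1 − ½)·(Acst·¼·e^{−½}∕2)∕2`, END `K₀·1∕(2 − 1)`), and the END's
constant exceeds the floor coefficient by exactly `32·e^{1∕2}·K₀∕Acst = 18432·e^{3∕2}·K₀(64,8)²` (`Acst = (e·K₀(64,8)·9·64)⁻¹`). [folklore] -/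
theorem slack_located :
    (1 - 2 * 1 * (1 / 4 : ℝ)) * cM (1 / 4) * ((1 / 4) * Real.sqrt (Real.pi / 2)) * 1 / 2 = Acst * Real.exp (-(1 / 2)) / 32 ∧
      K₀ 64 8 * (1 / (2 - 1)) / (Acst * Real.exp (-(1 / 2)) / 32) = 18432 * Real.exp (3 / 2) * K₀ 64 8 ^ 2 := by
  refine ⟨?_, ?_⟩
  · have h := cM_mul_moment (1 / 4)
    have he : Real.exp (-(2 * (1 / 4 : ℝ))) = Real.exp (-(1 / 2)) := by norm_num
    rw [he] at h
    calc (1 - 2 * 1 * (1 / 4 : ℝ)) * cM (1 / 4) * ((1 / 4) * Real.sqrt (Real.pi / 2)) * 1 / 2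
        = (cM (1 / 4) * ((1 / 4) * Real.sqrt (Real.pi / 2))) / 4 := by ring
      _ = Acst * Real.exp (-(1 / 2)) / 32 := by rw [h]; ring
  · unfold Acst
    have hK := K₀_pos (64 : ℝ) 8
    have he : Real.exp (3 / 2 : ℝ) = Real.exp 1 * Real.exp (1 / 2) := by rw [← Real.exp_add]; norm_num
    have he' : Real.exp (-(1 / 2 : ℝ)) = (Real.exp (1 / 2))⁻¹ := Real.exp_neg _
    rw [he, he']
    have h1 := Real.exp_pos (1 : ℝ)
    have h2 := Real.exp_pos (1 / 2 : ℝ)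
    field_simp
    ring

section Decided
variable (N : ℕ) [NeZero N]

open Classical in
/-- **THE SANDWICH, DECIDED** at `(r, μ₀, μ₁) = (¼, 1, 2)` and the NON-REAL source `μ = I` (`‖I‖ = 1`): `Acst·e^{−1∕2}∕32 ≤ ‖E_I(X₀) − E_0(X₀)‖ ≤ K₀(64,8)`
on W35's datum — both sides BY NAME (§4), the floor's letter by §5. [folklore] -/
example (k : ℕ) :
    Acst * Real.exp (-(1 / 2)) / 32 ≤
        ‖locE (tgeometry 4 N).ι (tgeometry 4 N).cubes (actM N (1 / 4) (by norm_num) k Complex.I) ((tgeometry 4 N).cubes (X₀ N)) -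
          locE (tgeometry 4 N).ι (tgeometry 4 N).cubes (actM N (1 / 4) (by norm_num) k 0) ((tgeometry 4 N).cubes (X₀ N))‖ ∧
      ‖locE (tgeometry 4 N).ι (tgeometry 4 N).cubes (actM N (1 / 4) (by norm_num) k Complex.I) ((tgeometry 4 N).cubes (X₀ N)) -
          locE (tgeometry 4 N).ι (tgeometry 4 N).cubes (actM N (1 / 4) (by norm_num) k 0) ((tgeometry 4 N).cubes (X₀ N))‖ ≤ K₀ 64 8 := by
  have hq : (1 : ℝ) * (1 / 4) ≤ 1 := by norm_num
  have h := coresMuEnd_sandwich N (1 / 4) (by norm_num) k (μ₁ := 2) (μ₀ := 1) le_rfl one_pos one_lt_two hq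
    (μ := Complex.I) (by rw [Complex.norm_I])
  rw [sub_zero, Complex.norm_I, slack_located.1] at h
  have h2 : K₀ 64 8 * (1 / (2 - 1)) = K₀ 64 8 := by norm_num
  rw [h2] at h
  exact h

end Decided

end Summit.QuantumFields.BalabanUV.T4Continuum.NE1p.DressedSmallFieldPencilFloor

end
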